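import Literature.Analysis.FluidPDE.EulerSymGradEnergy
import Literature.Analysis.FluidPDE.MollifiedSliceTools
import HarnessLib

/-!
# The cross identity between a Leray–Hopf solution and a weak Euler solution with
`∇v + ∇vᵀ ∈ L¹(0,T; L^∞)`

Analysis/FluidPDE support file (serves the discharge of the barrier fact
`Literature.Barriers.AnomalousDissipation.BrenierDeLellisSzekelyhidi2011_cor1`, Brenier–De Lellis–
Székelyhidi 2011, Cor. 1). Let `u` be an unforced Leray–Hopf solution with viscosity `ν ≥ 0` and
datum `v₀ ∈ L²`, and `v` a weak Euler solution with the same datum, continuous into `L²`, with a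
jointly measurable weak-gradient witness `G` whose symmetric part `S = G + Gᵀ` satisfies the
printed condition (8). For a spatial bump kernel `φ` write `Ψ(σ) = φ ⋆ v(σ)` and
`U(s) = φ ⋆ u(s)`.

**Main result** (`leray_euler_cross_identity`): for every `t ∈ (0, T]`
`⟨u(t), Ψ(t)⟩ = ⟨v₀, φ ⋆ v₀⟩ + ∫₀ᵗ ( ∫ (⟪u, DΨ u⟫ + ν ⟪u, ΔΨ⟫) - ∫ ⟪S v, U⟫ ) ds`.

This is the relative-energy ("weak–strong") pairing of Brenier–De Lellis–Székelyhidi, proof of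
Thm. 2 (there written for the measure-valued limit and the test field `χ(t) φ_k(x) v`), here for
each Leray solution separately and with the mollified field `φ ⋆ v` in place of the cut-off
`φ_k v`: no pressure and no Korn inequality are needed, the time derivative of `v` being the
`L²` field `-P(S v)` (`EulerSymGradEnergy`).

**Proof.** Serrin's doubling of the time variable (`FunctionSpaces.doubling_identity`) for
`Q(s,σ) = ⟨u(s), Ψ(σ)⟩ = ⟨U(s), v(σ)⟩` (symmetry of mollification,
`integral_inner_normed_convolution_comm`): in `s` the representation is the time-sliced weak
formulation of `u` tested with `Ψ(σ)` (`IsLerayHopfOn.inner_normed_convolution_eq`), in `σ` it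
is the absolute continuity of `v` paired with `U(s)` (`euler_integral_inner_eq_sub_setIntegral`);
the boundary data are continuous by `v ∈ C([0,T];L²)` and the weak `L²`-continuity of `u`, with
the common corner value `⟨v₀, φ ⋆ v₀⟩` (`euler_integral_inner_zero_eq`). The bulk limits: the
Laplacian term by the `L²–L²` lemma, the convective term frame-wise by the `L¹–L^∞` lemma
(`|⟪u,bᵢ⟫ u| ∈ L¹`, `DΨ bᵢ` bounded), the Euler term by the `L¹ₜL²ₓ–L^∞ₜL²ₓ` lemma.

## References

* Y. Brenier, C. De Lellis, L. Székelyhidi Jr., *Weak-strong uniqueness for measure-valued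
  solutions*, Comm. Math. Phys. 305 (2011), §3.1, proof of Thm. 2, (9)–(13).
  [BrenierDeLellisSzekelyhidi2011]
* J. Serrin, *The initial value problem for the Navier–Stokes equations* (1963), §4. [Serrin1963]
-/

noncomputable section

open MeasureTheory TopologicalSpace Set Function Filter ContinuousLinearMap InnerProductSpace
open scoped ENNReal NNReal Convolution RealInnerProductSpace Topology Laplacian

namespace Literature.Analysis.FluidPDE

variable {E : Type*} [NormedAddCommGroup E] [InnerProductSpace ℝ E] [FiniteDimensional ℝ E]
  [MeasurableSpace E] [BorelSpace E] [CompleteSpace E]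

/-! ### Slice-wise tools -/

section SliceTools

omit [CompleteSpace E] in
/-- Symmetry of the real `L²` pairing (local copy). [folklore] -/
private theorem integral_inner_comm_aux' (f g : E → E) : ∫ x, ⟪f x, g x⟫ = ∫ x, ⟪g x, f x⟫ :=
  integral_congr_ae (ae_of_all _ fun _ => real_inner_comm _ _)

omit [CompleteSpace E] in
/-- **Frame splitting of the convective pairing.** For `a ∈ L²` and a measurable operator field
`L` bounded by `M`: each `x ↦ ⟪⟪a x, bᵢ⟫ a x, L x bᵢ⟫` is integrable and
`∫ ⟪a, L a⟫ = Σᵢ ∫ ⟪⟪a, bᵢ⟫ a, L bᵢ⟫`. [folklore] -/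
theorem integral_inner_clm_apply_self_eq_sum {ι : Type*} [Fintype ι] (b : OrthonormalBasis ι ℝ E)
    {a : E → E} (ha : MemLp a 2 volume) {L : E → E →L[ℝ] E} (hL : AEStronglyMeasurable L volume)
    {M : ℝ} (hM : ∀ x, ‖L x‖ ≤ M) :
    (∀ i, Integrable (fun x => ⟪⟪a x, b i⟫ • a x, L x (b i)⟫) volume) ∧
      ∫ x, ⟪a x, L x (a x)⟫ = ∑ i, ∫ x, ⟪⟪a x, b i⟫ • a x, L x (b i)⟫ := by
  have ha2 : Integrable (fun x => ‖a x‖ ^ 2) volume := (memLp_two_iff_integrable_sq_norm ha.1).1 ha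
  have hM0 : 0 ≤ M := (norm_nonneg _).trans (hM 0)
  have hint : ∀ i, Integrable (fun x => ⟪⟪a x, b i⟫ • a x, L x (b i)⟫) volume := by
    intro i
    have hm : AEStronglyMeasurable (fun x => ⟪⟪a x, b i⟫ • a x, L x (b i)⟫) volume :=
      ((ha.1.inner aestronglyMeasurable_const).smul ha.1).inner (hL.apply_continuousLinearMap _)
    refine (ha2.const_mul M).mono' hm (ae_of_all _ fun x => ?_)
    rw [Real.norm_eq_abs]
    calc |⟪⟪a x, b i⟫ • a x, L x (b i)⟫| ≤ ‖⟪a x, b i⟫ • a x‖ * ‖L x (b i)‖ :=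
          abs_real_inner_le_norm _ _
      _ ≤ (‖a x‖ * ‖a x‖) * M := by
          rw [norm_smul]
          refine mul_le_mul (mul_le_mul_of_nonneg_right ?_ (norm_nonneg _)) ?_ (norm_nonneg _)
            (by positivity)
          · exact (abs_real_inner_le_norm _ _).trans (by rw [b.orthonormal.1 i, mul_one])
          · exact (le_opNorm _ _).trans (by rw [b.orthonormal.1 i, mul_one]; exact hM x)
      _ = M * ‖a x‖ ^ 2 := by ring
  refine ⟨hint, ?_⟩
  rw [← integral_finsetSum _ fun i _ => hint i]
  refine integral_congr_ae (ae_of_all _ fun x => ?_)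
  exact inner_clm_apply_self_eq_sum b (L x) (a x)

omit [CompleteSpace E] in
/-- **Kernel-weighted `L¹ – L^∞` pairing on the time square is integrable.** If `Φ` is integrable
on `(0,t) × E` and `‖D s x‖ ≤ C` everywhere (both jointly measurable), then
`(σ, s) ↦ ρ(s - σ) ∫ ⟪Φ(s), D(σ)⟫` is integrable on `(0,t)²`. [folklore] -/
theorem integrable_normed_mul_integral_inner_of_bound (ρ : ContDiffBump (0 : ℝ)) {t : ℝ}
    {D Φ : ℝ → E → E} (hD : StronglyMeasurable (uncurry D)) (hΦ : StronglyMeasurable (uncurry Φ))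
    (hΦ1 : Integrable (uncurry Φ) ((volume.restrict (Ioo 0 t)).prod (volume : Measure E)))
    {C : ℝ} (hC : ∀ s x, ‖D s x‖ ≤ C) :
    Integrable (fun p : ℝ × ℝ => ρ.normed volume (p.2 - p.1) * ∫ x, ⟪Φ p.2 x, D p.1 x⟫)
      ((volume.restrict (Ioo 0 t)).prod (volume.restrict (Ioo 0 t))) := by
  set νt : Measure ℝ := volume.restrict (Ioo 0 t) with hνt
  haveI : IsFiniteMeasure νt := by rw [hνt]; infer_instance
  obtain ⟨Cρ, hCρ0, hCρ⟩ := FunctionSpaces.exists_normed_le ρ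
  have hC0 : 0 ≤ C := (norm_nonneg _).trans (hC 0 0)
  have hIm := stronglyMeasurable_integral_inner_slice (μ := (volume : Measure E)) hD hΦ
  have hm : AEStronglyMeasurable (fun p : ℝ × ℝ => ρ.normed volume (p.2 - p.1) *
      ∫ x, ⟪Φ p.2 x, D p.1 x⟫) (νt.prod νt) :=
    ((ρ.continuous_normed.comp (continuous_snd.sub continuous_fst)).aestronglyMeasurable).mul
      hIm.aestronglyMeasurable
  -- the majorant `Cρ C ∫ ‖Φ(s, x)‖ dx`
  have hN : Integrable (fun s => ∫ x, ‖uncurry Φ (s, x)‖) νt := hΦ1.integral_norm_prod_left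
  have hmaj : Integrable (fun p : ℝ × ℝ => (Cρ * C) * ∫ x, ‖uncurry Φ (p.2, x)‖) (νt.prod νt) := by
    have h := (integrable_const (Cρ * C)).mul_prod hN (μ := νt)
    exact h
  have hslice : ∀ᵐ s ∂νt, Integrable (fun x => uncurry Φ (s, x)) volume :=
    ((integrable_prod_iff hΦ1.1).1 hΦ1).1
  refine hmaj.mono' hm ?_
  filter_upwards [(Measure.quasiMeasurePreserving_snd (μ := νt) (ν := νt)).ae hslice] with p hp
  rw [norm_mul, Real.norm_eq_abs, abs_of_nonneg (ρ.nonneg_normed _)]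
  have h1 : ‖∫ x, ⟪Φ p.2 x, D p.1 x⟫‖ ≤ ∫ x, ‖uncurry Φ (p.2, x)‖ * C := by
    refine norm_integral_le_of_norm_le (hp.norm.mul_const C) (ae_of_all _ fun x => ?_)
    calc ‖⟪Φ p.2 x, D p.1 x⟫‖ ≤ ‖Φ p.2 x‖ * ‖D p.1 x‖ := norm_inner_le_norm _ _
      _ ≤ ‖uncurry Φ (p.2, x)‖ * C := mul_le_mul_of_nonneg_left (hC _ _) (norm_nonneg _)
  rw [integral_mul_const] at h1
  calc ρ.normed volume (p.2 - p.1) * ‖∫ x, ⟪Φ p.2 x, D p.1 x⟫‖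
      ≤ Cρ * ((∫ x, ‖uncurry Φ (p.2, x)‖) * C) :=
        mul_le_mul (hCρ _) h1 (norm_nonneg _) hCρ0
    _ = Cρ * C * ∫ x, ‖uncurry Φ (p.2, x)‖ := by ring

end SliceTools

/-! ### The cross identity -/

section Cross

variable {T ν : ℝ} {v₀ : E → E} {u v : ℝ → E → E} {G : ℝ → E → E →L[ℝ] E}

omit [CompleteSpace E] in
/-- **The flux of a Leray–Hopf solution against a mollified `L²` field is integrable in time**,
with the uniform bound `|∫ (⟪u, DΨ u⟫ + ν⟪u, ΔΨ⟫)| ≤ ‖Dφ‖₂‖w‖₂ R² + |ν| R ‖Δφ‖₁ ‖w‖₂` on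
`[0,T]` when `‖u(s)‖_{L²} ≤ R` there (`Ψ = φ ⋆ w`). [folklore] -/
theorem IsLerayHopfOn.integrableOn_flux_normed_convolution (hu : IsLerayHopfOn T ν 0 v₀ u)
    {R : ℝ≥0} (hR : ∀ s ∈ Icc 0 T, eLpNorm (u s) 2 volume ≤ R) (φ : ContDiffBump (0 : E))
    {w : E → E} (hw : MemLp w 2 volume) :
    IntegrableOn (fun τ => ∫ x, (⟪u τ x, fderiv ℝ (φ.normed volume ⋆[lsmul ℝ ℝ, volume] w) x
        (u τ x)⟫ + ν * ⟪u τ x, (Δ (φ.normed volume ⋆[lsmul ℝ ℝ, volume] w)) x⟫)) (Ioo 0 T) ∧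
      ∀ τ ∈ Icc 0 T, |∫ x, (⟪u τ x, fderiv ℝ (φ.normed volume ⋆[lsmul ℝ ℝ, volume] w) x (u τ x)⟫ +
          ν * ⟪u τ x, (Δ (φ.normed volume ⋆[lsmul ℝ ℝ, volume] w)) x⟫)| ≤
        (eLpNorm (fderiv ℝ (φ.normed volume)) 2 volume).toReal * (eLpNorm w 2 volume).toReal *
            R * R +
          |ν| * (R * ((∫⁻ y, ‖(Δ (φ.normed volume)) y‖ₑ) * eLpNorm w 2 volume).toReal) := by
  set ρ : E → ℝ := φ.normed volume with hρ
  set Ψ : E → E := ρ ⋆[lsmul ℝ ℝ, volume] w with hΨ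
  have hwl : LocallyIntegrable w volume := hw.locallyIntegrable one_le_two
  have hΨs : ContDiff ℝ 2 Ψ := contDiff_normed_convolution_of_locallyIntegrable φ hwl
  have hDΨc : Continuous (fderiv ℝ Ψ) := hΨs.continuous_fderiv two_ne_zero
  have hΔΨc : Continuous (Δ Ψ) := continuous_laplacian hΨs
  obtain ⟨hΔΨ2, hΔΨle⟩ := memLp_laplacian_normed_convolution φ hw
  set K₁ : ℝ := (eLpNorm (fderiv ℝ ρ) 2 volume).toReal with hK₁
  have bΨ : ∀ x, ‖fderiv ℝ Ψ x‖ ≤ K₁ * (eLpNorm w 2 volume).toReal := fun x =>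
    norm_fderiv_normed_convolution_le φ hw x
  have hK₂ : (∫⁻ y, ‖(Δ ρ) y‖ₑ) ≠ ⊤ := (integrable_laplacian_normed φ).2.ne
  have hΔtoReal : (eLpNorm (Δ Ψ) 2 volume).toReal ≤
      ((∫⁻ y, ‖(Δ ρ) y‖ₑ) * eLpNorm w 2 volume).toReal :=
    ENNReal.toReal_mono (ENNReal.mul_ne_top hK₂ hw.eLpNorm_ne_top) hΔΨle
  have hN : ∀ s ∈ Icc 0 T, (eLpNorm (u s) 2 volume).toReal ≤ R := fun s hs => by
    have := ENNReal.toReal_mono ENNReal.coe_ne_top (hR s hs)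
    rwa [ENNReal.coe_toReal] at this
  -- the slice bound
  have hslice : ∀ τ ∈ Icc 0 T, |∫ x, (⟪u τ x, fderiv ℝ Ψ x (u τ x)⟫ + ν * ⟪u τ x, (Δ Ψ) x⟫)| ≤
      K₁ * (eLpNorm w 2 volume).toReal * R * R +
        |ν| * (R * ((∫⁻ y, ‖(Δ ρ) y‖ₑ) * eLpNorm w 2 volume).toReal) := by
    intro τ hτ
    have huτ : MemLp (u τ) 2 volume := hu.memLp τ hτ
    obtain ⟨i1, b1⟩ := abs_integral_inner_clm_apply_le_of_norm_le huτ huτ hDΨc.aestronglyMeasurable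
      (by positivity) bΨ
    have i2 : Integrable (fun x => ⟪u τ x, (Δ Ψ) x⟫) volume := integrable_inner_of_memLp_two huτ hΔΨ2
    rw [integral_add i1 (i2.const_mul ν), integral_const_mul]
    refine (abs_add_le _ _).trans (add_le_add ?_ ?_)
    · refine b1.trans ?_
      have hN0 : 0 ≤ (eLpNorm (u τ) 2 volume).toReal := ENNReal.toReal_nonneg
      have h1 := hN τ hτ
      have := mul_le_mul h1 h1 hN0 R.2
      have hc0 : 0 ≤ K₁ * (eLpNorm w 2 volume).toReal := by positivity
      nlinarith
    · rw [abs_mul]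
      refine mul_le_mul_of_nonneg_left ?_ (abs_nonneg ν)
      refine (abs_integral_inner_le_toReal_eLpNorm_mul huτ hΔΨ2).trans ?_
      exact mul_le_mul (hN τ hτ) hΔtoReal ENNReal.toReal_nonneg R.2
  refine ⟨?_, hslice⟩
  refine ⟨aestronglyMeasurable_flux_of_continuous hu.weak.1 hDΨc hΔΨc, ?_⟩
  refine HasFiniteIntegral.of_bounded (C := K₁ * (eLpNorm w 2 volume).toReal * R * R +
    |ν| * (R * ((∫⁻ y, ‖(Δ ρ) y‖ₑ) * eLpNorm w 2 volume).toReal)) ?_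
  filter_upwards [ae_restrict_mem measurableSet_Ioo] with τ hτ
  rw [Real.norm_eq_abs]
  exact hslice τ (Ioo_subset_Icc_self hτ)

/-- **The cross identity** (Brenier–De Lellis–Székelyhidi 2011, proof of Thm. 2, relative-energy
pairing; here for a Leray solution `u` and the mollified field `φ ⋆ v`). With `Ψ(σ) = φ ⋆ v(σ)`,
`U(s) = φ ⋆ u(s)`, `S = G + Gᵀ`, for every `t ∈ (0, T]`:
`⟨u(t), Ψ(t)⟩ = ⟨v₀, φ ⋆ v₀⟩ + ∫_{(0,t)} ( ∫ (⟪u, DΨ u⟫ + ν ⟪u, ΔΨ⟫) dx - ∫ ⟪S v, U⟫ dx ) ds`.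
See the module docstring for the proof. [cite: BrenierDeLellisSzekelyhidi2011, §3.1 proof of Thm. 2] -/
theorem leray_euler_cross_identity (hT : 0 < T) (hν : 0 ≤ ν) (hu : IsLerayHopfOn T ν 0 v₀ u)
    (hv : IsWeakNSSolutionOn T 0 0 v₀ v) (hc : ContinuousInLpOn (Icc 0 T) 2 v)
    (hv₀ : MemLp v₀ 2 volume) (hv₀div : IsWeaklyDivFree v₀)
    (hG : ∀ᵐ t ∂(volume.restrict (Ioo 0 T)), HasWeakGradient (v t) (G t))
    (hGm : StronglyMeasurable (uncurry G))
    (hS : ∫⁻ t in Ioo 0 T, eLpNorm (fun x => G t x + adjoint (G t x)) ∞ volume < ∞)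
    (φ : ContDiffBump (0 : E)) {t : ℝ} (ht : t ∈ Ioc 0 T) :
    ∫ x, ⟪u t x, (φ.normed volume ⋆[lsmul ℝ ℝ, volume] v t) x⟫ =
      (∫ x, ⟪v₀ x, (φ.normed volume ⋆[lsmul ℝ ℝ, volume] v₀) x⟫) +
      ∫ s in Ioo 0 t, ((∫ x, (⟪u s x, fderiv ℝ (φ.normed volume ⋆[lsmul ℝ ℝ, volume] v s) x
          (u s x)⟫ + ν * ⟪u s x, (Δ (φ.normed volume ⋆[lsmul ℝ ℝ, volume] v s)) x⟫)) -
        ∫ x, ⟪(G s x + adjoint (G s x)) (v s x),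
          (φ.normed volume ⋆[lsmul ℝ ℝ, volume] u s) x⟫) := by
  obtain ⟨φn, hφn, h'φn⟩ := FunctionSpaces.exists_contDiffBump_seq (E := ℝ)
  set b := stdOrthonormalBasis ℝ E with hb
  set ρ : E → ℝ := φ.normed volume with hρ
  set S : ℝ → E → E →L[ℝ] E := fun t x => G t x + adjoint (G t x) with hSdef
  set νt : Measure ℝ := volume.restrict (Ioo 0 t) with hνt
  haveI : IsFiniteMeasure νt := by rw [hνt]; infer_instance
  have htT : Ioo (0 : ℝ) t ⊆ Ioo 0 T := Ioo_subset_Ioo le_rfl ht.2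
  have hIoc : ∀ s ∈ Ioc 0 t, s ∈ Icc 0 T := fun s hs => ⟨hs.1.le, hs.2.trans ht.2⟩
  have hsubIoo : Ioo 0 t ⊆ Icc 0 T := fun x hx => ⟨hx.1.le, hx.2.le.trans ht.2⟩
  have hSm : StronglyMeasurable (uncurry S) := stronglyMeasurable_uncurry_symGrad hGm
  -- kernel data
  have hρc : Continuous ρ := φ.continuous_normed
  have hρcs : HasCompactSupport ρ := φ.hasCompactSupport_normed
  have hρ2 : ContDiff ℝ 2 ρ := φ.contDiff_normed
  have hDρc : Continuous (fderiv ℝ ρ) := (φ.contDiff_normed (n := 1)).continuous_fderiv one_ne_zero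
  have hΔρc : Continuous (Δ ρ) := continuous_laplacian hρ2
  set K₁ : ℝ := (eLpNorm (fderiv ℝ ρ) 2 volume).toReal with hK₁
  have hK₁0 : 0 ≤ K₁ := ENNReal.toReal_nonneg
  set K₂ : ℝ≥0∞ := ∫⁻ y, ‖(Δ ρ) y‖ₑ with hK₂def
  have hK₂ : K₂ ≠ ⊤ := (integrable_laplacian_normed φ).2.ne
  -- ### `L²` bounds of the slices
  obtain ⟨Rv, hRv⟩ := hc.exists_eLpNorm_le_of_Icc
  set Ru : ℝ≥0 := (eLpNorm v₀ 2 volume).toNNReal with hRudef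
  have hRu_eq : (Ru : ℝ≥0∞) = eLpNorm v₀ 2 volume := ENNReal.coe_toNNReal hv₀.eLpNorm_ne_top
  have hRu : ∀ s ∈ Icc 0 T, eLpNorm (u s) 2 volume ≤ Ru := fun s hs => by
    rw [hRu_eq]; exact hu.eLpNorm_le_eLpNorm_datum hν hv₀ hs
  have hNu : ∀ s ∈ Icc 0 T, (eLpNorm (u s) 2 volume).toReal ≤ Ru := fun s hs => by
    have := ENNReal.toReal_mono ENNReal.coe_ne_top (hRu s hs)
    rwa [ENNReal.coe_toReal] at this
  have hNv : ∀ s ∈ Icc 0 T, (eLpNorm (v s) 2 volume).toReal ≤ Rv := fun s hs => by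
    have := ENNReal.toReal_mono ENNReal.coe_ne_top (hRv s hs)
    rwa [ENNReal.coe_toReal] at this
  set N₀ : ℝ := (eLpNorm v₀ 2 volume).toReal with hN₀
  have hN₀0 : 0 ≤ N₀ := ENNReal.toReal_nonneg
  -- the mollified slices
  set Ψ : ℝ → E → E := fun σ => ρ ⋆[lsmul ℝ ℝ, volume] v σ with hΨdef
  set U : ℝ → E → E := fun s => ρ ⋆[lsmul ℝ ℝ, volume] u s with hUdef
  set w₀ : E → E := ρ ⋆[lsmul ℝ ℝ, volume] v₀ with hw₀
  have hw₀2 : MemLp w₀ 2 volume := FunctionSpaces.memLp_normed_convolution φ hv₀ one_le_two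
  have hw₀div : IsWeaklyDivFree w₀ :=
    isWeaklyDivFree_normed_convolution φ (hv₀.locallyIntegrable one_le_two) hv₀div
  have hΨ2 : ∀ σ ∈ Icc 0 T, MemLp (Ψ σ) 2 volume := fun σ hσ =>
    FunctionSpaces.memLp_normed_convolution φ (hc.1 σ hσ) one_le_two
  have hU2 : ∀ s ∈ Icc 0 T, MemLp (U s) 2 volume := fun s hs =>
    FunctionSpaces.memLp_normed_convolution φ (hu.memLp s hs) one_le_two
  have hNΨ : ∀ σ ∈ Icc 0 T, (eLpNorm (Ψ σ) 2 volume).toReal ≤ Rv := fun σ hσ =>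
    (ENNReal.toReal_mono (hc.1 σ hσ).eLpNorm_ne_top
      (FunctionSpaces.eLpNorm_normed_convolution_le φ (hc.1 σ hσ).1 one_le_two)).trans (hNv σ hσ)
  have hNw₀ : (eLpNorm w₀ 2 volume).toReal ≤ N₀ :=
    ENNReal.toReal_mono hv₀.eLpNorm_ne_top
      (FunctionSpaces.eLpNorm_normed_convolution_le φ hv₀.1 one_le_two)
  -- good times for `u` and `v`
  have hgood := euler_ae_good_time hv hG hGm hS
  have hgoodv : ∀ᵐ s ∂νt, s ∈ Ioo 0 T ∧ IsWeaklyDivFree (v s) ∧ HasWeakGradient (v s) (G s) ∧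
      eLpNorm (S s) ∞ volume < ∞ ∧ ∀ᵐ x ∂(volume : Measure E), ‖S s x‖ ≤
        (eLpNorm (S s) ∞ volume).toReal := ae_restrict_of_ae_restrict_of_subset htT hgood
  have hgoodu : ∀ᵐ s ∂νt, s ∈ Ioo 0 T ∧ IsWeaklyDivFree (u s) := by
    have h := hu.weak.2.2.1
    filter_upwards [ae_restrict_mem measurableSet_Ioo,
      ae_restrict_of_ae_restrict_of_subset htT h] with s hs hdiv
    exact ⟨htT hs, hdiv⟩
  -- ### the data of the doubling identity
  set L₀ : ℝ := ∫ x, ⟪v₀ x, w₀ x⟫ with hL₀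
  obtain ⟨Q, hQ⟩ : ∃ F : ℝ → ℝ → ℝ, F = fun s σ => ∫ x, ⟪u s x, Ψ σ x⟫ := ⟨_, rfl⟩
  obtain ⟨c, hcdef⟩ : ∃ F : ℝ → ℝ, F = fun σ => ∫ x, ⟪v₀ x, Ψ σ x⟫ := ⟨_, rfl⟩
  obtain ⟨c', hc'def⟩ : ∃ F : ℝ → ℝ, F = fun s => ∫ x, ⟪u s x, w₀ x⟫ := ⟨_, rfl⟩
  obtain ⟨f, hf⟩ : ∃ F : ℝ → ℝ → ℝ, F = fun σ τ =>
    ∫ x, (⟪u τ x, fderiv ℝ (Ψ σ) x (u τ x)⟫ + ν * ⟪u τ x, (Δ (Ψ σ)) x⟫) := ⟨_, rfl⟩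
  obtain ⟨g, hg⟩ : ∃ F : ℝ → ℝ → ℝ, F = fun s τ => -∫ x, ⟪S τ x (v τ x), U s x⟫ := ⟨_, rfl⟩
  -- ### versions
  have hum : AEStronglyMeasurable (uncurry u)
      (((volume : Measure ℝ).restrict (Ioo 0 T)).prod (volume : Measure E)) := by
    rw [restrict_prod_volume_eq]; exact hu.weak.1
  have hvm : AEStronglyMeasurable (uncurry v)
      (((volume : Measure ℝ).restrict (Ioo 0 T)).prod (volume : Measure E)) := by
    rw [restrict_prod_volume_eq]; exact hv.1
  have hRuae : ∀ᵐ s ∂(volume.restrict (Ioo 0 T)), eLpNorm (u s) 2 volume ≤ Ru := by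
    filter_upwards [ae_restrict_mem measurableSet_Ioo] with s hs
    exact hRu s (Ioo_subset_Icc_self hs)
  have hRvae : ∀ᵐ s ∂(volume.restrict (Ioo 0 T)), eLpNorm (v s) 2 volume ≤ Rv := by
    filter_upwards [ae_restrict_mem measurableSet_Ioo] with s hs
    exact hRv s (Ioo_subset_Icc_self hs)
  obtain ⟨ut, hutm, hutR, hut⟩ := exists_version_of_eLpNorm_le hum hRuae
  obtain ⟨vt, hvtm, hvtR, hvt⟩ := exists_version_of_eLpNorm_le hvm hRvae
  have hut' : ∀ᵐ s ∂νt, ut s =ᵐ[volume] u s := ae_restrict_of_ae_restrict_of_subset htT hut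
  have hvt' : ∀ᵐ s ∂νt, vt s =ᵐ[volume] v s := ae_restrict_of_ae_restrict_of_subset htT hvt
  have hut2 : ∀ s, MemLp (ut s) 2 volume := fun s =>
    ⟨(hutm.of_uncurry_left (x := s)).aestronglyMeasurable, (hutR s).trans_lt ENNReal.coe_lt_top⟩
  have hvt2 : ∀ s, MemLp (vt s) 2 volume := fun s =>
    ⟨(hvtm.of_uncurry_left (x := s)).aestronglyMeasurable, (hvtR s).trans_lt ENNReal.coe_lt_top⟩
  -- the Euler flux through the version: `A s = S s (vt s)`
  set A : ℝ → E → E := fun s x => S s x (vt s x) with hA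
  have hAm : StronglyMeasurable (uncurry A) :=
    (ContinuousLinearMap.id ℝ (E →L[ℝ] E)).continuous₂.comp_stronglyMeasurable (hSm.prodMk hvtm)
  have hAt : ∀ᵐ s ∂νt, A s =ᵐ[volume] fun x => S s x (v s x) := by
    filter_upwards [hvt'] with s hs
    filter_upwards [hs] with x hx
    simp only [hA, hx]
  have hA1 : ∫⁻ s in Ioo 0 t, eLpNorm (A s) 2 volume < ∞ := by
    have hle : ∀ᵐ s ∂νt, eLpNorm (A s) 2 volume ≤ eLpNorm (S s) ∞ volume * Rv := by
      filter_upwards [hAt, ae_restrict_of_ae_restrict_of_subset htT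
        (euler_eLpNorm_symGrad_apply_le hv hG hGm hS hRv)] with s hs hs2
      rw [eLpNorm_congr_ae hs]; exact hs2
    calc ∫⁻ s in Ioo 0 t, eLpNorm (A s) 2 volume ≤ ∫⁻ s in Ioo 0 t, eLpNorm (S s) ∞ volume * Rv :=
          lintegral_mono_ae hle
      _ = (∫⁻ s in Ioo 0 t, eLpNorm (S s) ∞ volume) * Rv :=
          lintegral_mul_const _ (FunctionSpaces.measurable_eLpNorm_slice hSm ∞)
      _ < ∞ := ENNReal.mul_lt_top ((lintegral_mono_set htT).trans_lt hS) ENNReal.coe_lt_top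
  -- the mollified versions `Ut s = ρ ⋆ ut s`, `Ψt σ = ρ ⋆ vt σ`
  set Ut : ℝ → E → E := fun s => ρ ⋆[lsmul ℝ ℝ, volume] ut s with hUtdef
  set Ψt : ℝ → E → E := fun σ => ρ ⋆[lsmul ℝ ℝ, volume] vt σ with hΨtdef
  have hUtm : StronglyMeasurable (uncurry Ut) := stronglyMeasurable_uncurry_convolution_lsmul hρc hutm
  have hUtR : ∀ s, eLpNorm (Ut s) 2 volume ≤ Ru := fun s =>
    (FunctionSpaces.eLpNorm_normed_convolution_le φ (hut2 s).1 one_le_two).trans (hutR s)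
  have hUt_eq : ∀ᵐ s ∂νt, Ut s = U s := by
    filter_upwards [hut'] with s hs
    ext x; exact convolution_lsmul_congr_ae_right ρ hs x
  have hΨt_eq : ∀ᵐ σ ∂νt, Ψt σ = Ψ σ := by
    filter_upwards [hvt'] with σ hσ
    ext x; exact convolution_lsmul_congr_ae_right ρ hσ x
  -- the Laplacian of `Ψt`: `ΔΨt σ = (Δρ) ⋆ vt σ`
  set LΨt : ℝ → E → E := fun σ => (Δ ρ) ⋆[lsmul ℝ ℝ, volume] vt σ with hLΨtdef
  have hLΨt_eq : ∀ σ, Δ (Ψt σ) = LΨt σ := fun σ => by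
    ext x
    exact laplacian_convolution_lsmul hρ2 hρcs ((hvt2 σ).locallyIntegrable one_le_two) x
  have hLΨtm : StronglyMeasurable (uncurry LΨt) :=
    stronglyMeasurable_uncurry_convolution_lsmul hΔρc hvtm
  have hLΨtR : ∀ σ, eLpNorm (LΨt σ) 2 volume ≤ K₂ * Rv := fun σ => by
    rw [← hLΨt_eq]
    exact (memLp_laplacian_normed_convolution φ (hvt2 σ)).2.trans (mul_le_mul_right (hvtR σ) _)
  -- the frame components of `DΨt`: `DΨt i σ x = D(Ψt σ)(x) bᵢ = ((Dρ · bᵢ) ⋆ vt σ)(x)`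
  set DΨt : Fin (Module.finrank ℝ E) → ℝ → E → E := fun i σ x => fderiv ℝ (Ψt σ) x (b i)
    with hDΨtdef
  have hDΨt_eq : ∀ i σ x, DΨt i σ x = ((fun z => fderiv ℝ ρ z (b i)) ⋆[lsmul ℝ ℝ, volume] vt σ) x :=
    fun i σ x => fderiv_convolution_lsmul_apply (φ.contDiff_normed (n := 1)) hρcs
      ((hvt2 σ).locallyIntegrable one_le_two) x (b i)
  have hDΨtm : ∀ i, StronglyMeasurable (uncurry (DΨt i)) := fun i => by
    have h := stronglyMeasurable_uncurry_convolution_lsmul (F := E) (X := ℝ)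
      (k := fun z => fderiv ℝ ρ z (b i)) (hDρc.clm_apply continuous_const) hvtm
    have heq : uncurry (DΨt i) =
        uncurry fun σ x => ((fun z => fderiv ℝ ρ z (b i)) ⋆[lsmul ℝ ℝ, volume] vt σ) x := by
      ext ⟨σ, x⟩; exact hDΨt_eq i σ x
    rw [heq]; exact h
  have hDΨt_bd : ∀ σ x, ‖fderiv ℝ (Ψt σ) x‖ ≤ K₁ * Rv := fun σ x =>
    (norm_fderiv_normed_convolution_le φ (hvt2 σ) x).trans (mul_le_mul_of_nonneg_left (by
      have := ENNReal.toReal_mono ENNReal.coe_ne_top (hvtR σ)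
      rwa [ENNReal.coe_toReal] at this) hK₁0)
  have hDΨtC : ∀ i σ x, ‖DΨt i σ x‖ ≤ K₁ * Rv := fun i σ x =>
    (le_opNorm _ _).trans (by rw [b.orthonormal.1 i, mul_one]; exact hDΨt_bd σ x)
  -- the frame components of `u ⊗ u`: `Φt i s x = ⟪ut s x, bᵢ⟫ ut s x ∈ L¹`
  set Φt : Fin (Module.finrank ℝ E) → ℝ → E → E := fun i s x => ⟪ut s x, b i⟫ • ut s x with hΦtdef
  have hΦtm : ∀ i, StronglyMeasurable (uncurry (Φt i)) := fun i =>
    (hutm.inner stronglyMeasurable_const).smul hutm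
  have hΦt1 : ∀ i, Integrable (uncurry (Φt i)) (νt.prod (volume : Measure E)) := by
    intro i
    have hsq : ∫⁻ z, ‖uncurry ut z‖ₑ ^ (2 : ℝ) ∂(νt.prod (volume : Measure E)) < ∞ := by
      have h := FunctionSpaces.lintegral_eLpNorm_slice_sq (ν := νt) (μ := (volume : Measure E)) hutm
      have h' : eLpNorm (uncurry ut) 2 (νt.prod (volume : Measure E)) =
          eLpNorm' (uncurry ut) 2 (νt.prod (volume : Measure E)) := by
        rw [eLpNorm_eq_eLpNorm' two_ne_zero ENNReal.ofNat_ne_top, ENNReal.toReal_ofNat]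
      rw [lintegral_rpow_enorm_eq_rpow_eLpNorm' zero_lt_two, ← h', ← h]
      calc ∫⁻ σ, eLpNorm (ut σ) 2 volume ^ (2 : ℝ) ∂νt ≤ ∫⁻ σ, (Ru : ℝ≥0∞) ^ (2 : ℝ) ∂νt :=
            lintegral_mono fun σ => ENNReal.rpow_le_rpow (hutR σ) zero_le_two
        _ < ∞ := by
            rw [lintegral_const]
            exact ENNReal.mul_lt_top (ENNReal.rpow_lt_top_of_nonneg zero_le_two ENNReal.coe_ne_top)
              (measure_lt_top _ _)
    refine ⟨(hΦtm i).aestronglyMeasurable, ?_⟩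
    refine lt_of_le_of_lt (lintegral_mono fun z => ?_) hsq
    simp only [hΦtdef, uncurry]
    rw [enorm_smul, ENNReal.rpow_two, sq]
    gcongr
    rw [← ofReal_norm, ← ofReal_norm, Real.norm_eq_abs]
    exact ENNReal.ofReal_le_ofReal ((abs_real_inner_le_norm _ _).trans
      (by rw [b.orthonormal.1 i, mul_one]))
  -- `L²((0,t) × E)` data for the Laplacian term
  have hsqb : ∀ {B : ℝ → E → E} (_ : StronglyMeasurable (uncurry B)) {K : ℝ≥0∞} (_ : K ≠ ⊤),
      (∀ s, eLpNorm (B s) 2 volume ≤ K) → eLpNorm (uncurry B) 2 (νt.prod (volume : Measure E)) < ∞ := by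
    intro B hB K hK hle
    have h := FunctionSpaces.lintegral_eLpNorm_slice_sq (ν := νt) (μ := (volume : Measure E)) hB
    have hfin : eLpNorm (uncurry B) 2 (νt.prod volume) ^ (2 : ℝ) < ⊤ := by
      rw [← h]
      calc ∫⁻ σ, eLpNorm (B σ) 2 volume ^ (2 : ℝ) ∂νt ≤ ∫⁻ σ, K ^ (2 : ℝ) ∂νt :=
            lintegral_mono fun σ => ENNReal.rpow_le_rpow (hle σ) zero_le_two
        _ < ∞ := by
            rw [lintegral_const]
            exact ENNReal.mul_lt_top (ENNReal.rpow_lt_top_of_nonneg zero_le_two hK)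
              (measure_lt_top _ _)
    by_contra htop
    rw [not_lt, top_le_iff] at htop
    rw [htop, ENNReal.top_rpow_of_pos zero_lt_two] at hfin
    exact lt_irrefl _ hfin
  have hut22 : eLpNorm (uncurry ut) 2 (νt.prod (volume : Measure E)) < ∞ :=
    hsqb hutm ENNReal.coe_ne_top hutR
  have hLΨt22 : eLpNorm (uncurry LΨt) 2 (νt.prod (volume : Measure E)) < ∞ :=
    hsqb hLΨtm (ENNReal.mul_ne_top hK₂ ENNReal.coe_ne_top) hLΨtR
  have hqfst := Measure.quasiMeasurePreserving_fst (μ := νt) (ν := νt)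
  have hqsnd := Measure.quasiMeasurePreserving_snd (μ := νt) (ν := νt)
  -- ### measurability of `Q`
  have hQm : AEStronglyMeasurable (fun p : ℝ × ℝ => Q p.2 p.1) (νt.prod νt) := by
    have hΨtm : StronglyMeasurable (uncurry Ψt) := stronglyMeasurable_uncurry_convolution_lsmul hρc hvtm
    have h1 := stronglyMeasurable_integral_inner_slice (μ := (volume : Measure E)) hΨtm hutm
    refine h1.aestronglyMeasurable.congr ?_
    filter_upwards [hqfst.ae hΨt_eq, hqsnd.ae hut'] with p hp1 hp2
    rw [hQ]
    dsimp only
    rw [hp1]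
    refine integral_congr_ae ?_
    filter_upwards [hp2] with x hx
    rw [hx]
  -- ### boundedness
  set B : ℝ := Ru * Rv + N₀ * Rv + Ru * N₀ with hBdef
  have hQb : ∀ s ∈ Ioc 0 t, ∀ σ ∈ Ioc 0 t, |Q s σ| ≤ B := by
    intro s hs σ hσ
    rw [hQ]
    refine (abs_integral_inner_le_toReal_eLpNorm_mul (hu.memLp s (hIoc s hs))
      (hΨ2 σ (hIoc σ hσ))).trans ?_
    have h3 : (eLpNorm (u s) 2 volume).toReal * (eLpNorm (Ψ σ) 2 volume).toReal ≤ Ru * Rv :=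
      mul_le_mul (hNu s (hIoc s hs)) (hNΨ σ (hIoc σ hσ)) ENNReal.toReal_nonneg Ru.2
    have : 0 ≤ N₀ * Rv + Ru * N₀ := by positivity
    linarith
  -- ### the two representations
  have hrepA : ∀ σ, σ ∈ Ioo 0 T → IsWeaklyDivFree (v σ) → ∀ s ∈ Ioc 0 t,
      Q s σ = c σ + ∫ τ in Ioo 0 s, f σ τ := by
    intro σ hσ hdivσ s hs
    have h1 := hu.inner_normed_convolution_eq hT hv₀ φ (hc.1 σ (Ioo_subset_Icc_self hσ)) hdivσ
      (t := s) ⟨hs.1, hs.2.trans ht.2⟩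
    simp only [hQ, hcdef, hf]
    rw [h1, setIntegral_congr_set (Ioo_ae_eq_Ioc (α := ℝ))]
  have hfint : ∀ σ ∈ Icc 0 T, IntegrableOn (f σ) (Ioo 0 t) := fun σ hσ => by
    obtain ⟨i1, -⟩ := hu.integrableOn_flux_normed_convolution hRu φ (hc.1 σ hσ)
    rw [hf]; exact i1.mono_set htT
  have hA' : ∀ᵐ σ ∂νt, IntegrableOn (f σ) (Ioo 0 t) ∧
      ∀ s ∈ Ioc 0 t, Q s σ = c σ + ∫ τ in Ioo 0 s, f σ τ := by
    filter_upwards [hgoodv] with σ hσ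
    exact ⟨hfint σ (Ioo_subset_Icc_self hσ.1), hrepA σ hσ.1 hσ.2.1⟩
  have hrepB : ∀ s, s ∈ Ioo 0 T → IsWeaklyDivFree (u s) → ∀ σ ∈ Ioc 0 t,
      Q s σ = (∫ x, ⟪v₀ x, U s x⟫) + ∫ τ in Ioo 0 σ, g s τ := by
    intro s hs hdivs σ hσ
    have hus : MemLp (u s) 2 volume := hu.memLp s (Ioo_subset_Icc_self hs)
    have hUs2 : MemLp (U s) 2 volume := hU2 s (Ioo_subset_Icc_self hs)
    have hUsdiv : IsWeaklyDivFree (U s) :=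
      isWeaklyDivFree_normed_convolution φ (hus.locallyIntegrable one_le_two) hdivs
    have h1 := euler_integral_inner_eq_sub_setIntegral hT hv hc hv₀ hG hGm hS hUs2 hUsdiv (hIoc σ hσ)
    simp only [hQ, hg]
    rw [integral_inner_normed_convolution_comm φ hus (hc.1 σ (hIoc σ hσ)), integral_inner_comm_aux',
      h1, sub_eq_add_neg, ← integral_neg, setIntegral_congr_set (Ioo_ae_eq_Ioc (α := ℝ))]
  have hc'_eq : ∀ s ∈ Icc 0 T, c' s = ∫ x, ⟪v₀ x, U s x⟫ := fun s hs => by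
    rw [hc'def]
    dsimp only
    rw [integral_inner_comm_aux', ← integral_inner_normed_convolution_comm φ hv₀ (hu.memLp s hs)]
  have hgint : ∀ s ∈ Icc 0 T, IntegrableOn (g s) (Ioo 0 t) := fun s hs => by
    obtain ⟨i1, -⟩ := euler_integrableOn_integral_inner_symGrad_apply hv hc hG hGm hS hRv (hU2 s hs)
    rw [hg]; exact (i1.mono_set htT).neg
  have hB' : ∀ᵐ s ∂νt, IntegrableOn (g s) (Ioo 0 t) ∧
      ∀ σ ∈ Ioc 0 t, Q s σ = c' s + ∫ τ in Ioo 0 σ, g s τ := by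
    filter_upwards [hgoodu] with s hs
    refine ⟨hgint s (Ioo_subset_Icc_self hs.1), fun σ hσ => ?_⟩
    rw [hc'_eq s (Ioo_subset_Icc_self hs.1)]
    exact hrepB s hs.1 hs.2 σ hσ
  -- ### continuity of the boundary data
  have hcΨ : ContinuousInLpOn (Icc 0 T) 2 Ψ := hc.normed_convolution φ
  have hcontΨ : ∀ {w : E → E}, MemLp w 2 volume →
      ContinuousOn (fun σ => ∫ x, ⟪w x, Ψ σ x⟫) (Icc 0 T) := by
    intro w hw
    exact (hcΨ.continuousOn_integral_inner hw).congr fun σ _ => integral_inner_comm_aux' _ _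
  have hmemut : MemLp (u t) 2 volume := hu.memLp t (hIoc t ⟨ht.1, le_rfl⟩)
  have hmemΨt : MemLp (Ψ t) 2 volume := hΨ2 t (hIoc t ⟨ht.1, le_rfl⟩)
  have hQ₁c : ContinuousOn (fun σ => Q t σ) (Icc 0 T) := by rw [hQ]; exact hcontΨ hmemut
  have hQ₂c : ContinuousOn (fun s => Q s t) (Ioc 0 T) := by
    rw [hQ]; exact (hu.weak_continuous (Ψ t) hmemΨt).1
  have hcc : ContinuousOn c (Icc 0 T) := by rw [hcdef]; exact hcontΨ hv₀
  have hc'c : ContinuousOn c' (Ioc 0 T) := by rw [hc'def]; exact (hu.weak_continuous w₀ hw₀2).1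
  have hleftIcc : ∀ {F : ℝ → ℝ}, ContinuousOn F (Icc 0 T) → Tendsto F (𝓝[<] t) (𝓝 (F t)) := by
    intro F hF
    have h1 := hF t (hIoc t ⟨ht.1, le_rfl⟩)
    rw [← nhdsWithin_Ioo_eq_nhdsLT ht.1]
    exact h1.mono_left (nhdsWithin_mono _ hsubIoo)
  have hleftIoc : ∀ {F : ℝ → ℝ}, ContinuousOn F (Ioc 0 T) → Tendsto F (𝓝[<] t) (𝓝 (F t)) := by
    intro F hF
    have h1 := hF t ⟨ht.1, ht.2⟩
    rw [← nhdsWithin_Ioo_eq_nhdsLT ht.1]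
    exact h1.mono_left (nhdsWithin_mono _ fun x hx => ⟨hx.1, hx.2.le.trans ht.2⟩)
  have hc0val : c 0 = L₀ := by
    rw [hcdef, hL₀]
    dsimp only
    rw [integral_inner_normed_convolution_comm φ hv₀ (hc.1 0 (left_mem_Icc.2 hT.le)),
      integral_inner_comm_aux', euler_integral_inner_zero_eq hT hv hc hv₀ hG hGm hS hw₀2 hw₀div]
  have hc0 : Tendsto c (𝓝[>] 0) (𝓝 L₀) :=
    hc0val ▸ (hcc 0 (left_mem_Icc.2 hT.le)).mono_of_mem_nhdsWithin (Icc_mem_nhdsGT hT)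
  have hc'0 : Tendsto c' (𝓝[>] 0) (𝓝 L₀) := by
    rw [hc'def, hL₀]; exact (hu.weak_continuous w₀ hw₀2).2
  have hcb : ∀ σ ∈ Ioo 0 t, |c σ| ≤ B := by
    intro σ hσ
    rw [hcdef]
    refine (abs_integral_inner_le_toReal_eLpNorm_mul hv₀ (hΨ2 σ (hsubIoo hσ))).trans ?_
    have h3 : N₀ * (eLpNorm (Ψ σ) 2 volume).toReal ≤ N₀ * Rv :=
      mul_le_mul_of_nonneg_left (hNΨ σ (hsubIoo hσ)) hN₀0
    have : 0 ≤ (Ru : ℝ) * Rv + Ru * N₀ := by positivity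
    linarith
  have hc'b : ∀ s ∈ Ioo 0 t, |c' s| ≤ B := by
    intro s hs
    rw [hc'def]
    refine (abs_integral_inner_le_toReal_eLpNorm_mul (hu.memLp s (hsubIoo hs)) hw₀2).trans ?_
    have h3 : (eLpNorm (u s) 2 volume).toReal * (eLpNorm w₀ 2 volume).toReal ≤ Ru * N₀ :=
      mul_le_mul (hNu s (hsubIoo hs)) hNw₀ ENNReal.toReal_nonneg Ru.2
    have : 0 ≤ (Ru : ℝ) * Rv + N₀ * Rv := by positivity
    linarith
  -- ### the Euler bulk term
  have hae_g : ∀ᵐ p ∂(νt.prod νt), g p.2 p.1 = -∫ x, ⟪Ut p.2 x, A p.1 x⟫ := by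
    filter_upwards [hqsnd.ae hUt_eq, hqfst.ae hAt] with p h2 h1
    rw [hg]
    dsimp only
    rw [integral_inner_comm_aux', ← h2]
    congr 1
    refine integral_congr_ae ?_
    filter_upwards [h1] with x hx
    rw [hx]
  have key_g_int : ∀ n, Integrable (fun p : ℝ × ℝ => (φn n).normed volume (p.2 - p.1) *
      ∫ x, ⟪Ut p.2 x, A p.1 x⟫) (νt.prod νt) := fun n =>
    (abs_integral_normed_mul_integral_inner_le (μ := (volume : Measure E)) (φn n) hAm hUtm hA1 hUtR).1
  set Zg : ℝ := ∫ z, ⟪Ut z.1 z.2, A z.1 z.2⟫ ∂(νt.prod (volume : Measure E)) with hZgdef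
  have key_g_lim : Tendsto (fun n => ∫ p, (φn n).normed volume (p.2 - p.1) *
      (∫ x, ⟪Ut p.2 x, A p.1 x⟫) ∂(νt.prod νt)) atTop (𝓝 Zg) :=
    tendsto_integral_normed_mul_integral_inner_of_eLpNorm_le hφn hAm hUtm hA1 hUtR
  have hgF : ∀ n, Integrable (fun p : ℝ × ℝ => (φn n).normed volume (p.2 - p.1) * g p.2 p.1)
      (νt.prod νt) := fun n => by
    refine ((key_g_int n).neg).congr ?_
    filter_upwards [hae_g] with p hp
    simp only [Pi.neg_apply, hp, mul_neg]
  have hg_lim : Tendsto (fun n => ∫ p, (φn n).normed volume (p.2 - p.1) * g p.2 p.1 ∂(νt.prod νt))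
      atTop (𝓝 (-Zg)) := by
    refine key_g_lim.neg.congr fun n => ?_
    rw [← integral_neg]
    refine integral_congr_ae ?_
    filter_upwards [hae_g] with p hp
    rw [hp, mul_neg]
  -- ### the Leray bulk term
  have hΨts : ∀ σ, ContDiff ℝ 2 (Ψt σ) := fun σ =>
    contDiff_normed_convolution_of_locallyIntegrable φ ((hvt2 σ).locallyIntegrable one_le_two)
  have hLΨt2 : ∀ σ, MemLp (LΨt σ) 2 volume := fun σ => by
    rw [← hLΨt_eq]; exact (memLp_laplacian_normed_convolution φ (hvt2 σ)).1
  -- slice identity: `f σ τ` through the versions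
  have hf_slice : ∀ σ s, Ψt σ = Ψ σ → ut s =ᵐ[volume] u s → s ∈ Icc 0 T →
      f σ s = (∑ i, ∫ x, ⟪Φt i s x, DΨt i σ x⟫) + ν * ∫ x, ⟪ut s x, LΨt σ x⟫ := by
    intro σ s hσ hs hsI
    have hus : MemLp (u s) 2 volume := hu.memLp s hsI
    have hDc : Continuous (fderiv ℝ (Ψt σ)) := (hΨts σ).continuous_fderiv two_ne_zero
    obtain ⟨i1, -⟩ := abs_integral_inner_clm_apply_le_of_norm_le (hut2 s) (hut2 s)
      hDc.aestronglyMeasurable (by positivity) (hDΨt_bd σ)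
    have i2 : Integrable (fun x => ⟪ut s x, LΨt σ x⟫) volume :=
      integrable_inner_of_memLp_two (hut2 s) (hLΨt2 σ)
    obtain ⟨-, hsum⟩ := integral_inner_clm_apply_self_eq_sum b (hut2 s) hDc.aestronglyMeasurable
      (hDΨt_bd σ)
    rw [hf]
    dsimp only
    rw [← hσ, hLΨt_eq σ]
    calc ∫ x, (⟪u s x, fderiv ℝ (Ψt σ) x (u s x)⟫ + ν * ⟪u s x, LΨt σ x⟫)
        = ∫ x, (⟪ut s x, fderiv ℝ (Ψt σ) x (ut s x)⟫ + ν * ⟪ut s x, LΨt σ x⟫) := by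
          refine integral_congr_ae ?_
          filter_upwards [hs] with x hx
          rw [hx]
      _ = (∫ x, ⟪ut s x, fderiv ℝ (Ψt σ) x (ut s x)⟫) + ν * ∫ x, ⟪ut s x, LΨt σ x⟫ := by
          rw [integral_add i1 (i2.const_mul ν), integral_const_mul]
      _ = (∑ i, ∫ x, ⟪Φt i s x, DΨt i σ x⟫) + ν * ∫ x, ⟪ut s x, LΨt σ x⟫ := by rw [hsum]
  have hae_f : ∀ᵐ p ∂(νt.prod νt), f p.1 p.2 =
      (∑ i, ∫ x, ⟪Φt i p.2 x, DΨt i p.1 x⟫) + ν * ∫ x, ⟪ut p.2 x, LΨt p.1 x⟫ := by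
    filter_upwards [hqfst.ae hΨt_eq, hqsnd.ae hut',
      hqsnd.ae (ae_restrict_mem measurableSet_Ioo : ∀ᵐ s ∂νt, s ∈ Ioo 0 t)] with p hp1 hp2 hp3
    exact hf_slice p.1 p.2 hp1 hp2 (hsubIoo hp3)
  -- integrability of the pieces on the square
  have hLΨt1 : ∫⁻ s in Ioo 0 t, eLpNorm (LΨt s) 2 volume < ∞ := by
    refine (lintegral_mono fun s => hLΨtR s).trans_lt ?_
    rw [lintegral_const]
    exact ENNReal.mul_lt_top (ENNReal.mul_lt_top hK₂.lt_top ENNReal.coe_lt_top) (measure_lt_top _ _)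
  have piece_i : ∀ i n, Integrable (fun p : ℝ × ℝ => (φn n).normed volume (p.2 - p.1) *
      ∫ x, ⟪Φt i p.2 x, DΨt i p.1 x⟫) (νt.prod νt) := fun i n =>
    integrable_normed_mul_integral_inner_of_bound (φn n) (hDΨtm i) (hΦtm i) (hΦt1 i) (hDΨtC i)
  have piece_Δ : ∀ n, Integrable (fun p : ℝ × ℝ => (φn n).normed volume (p.2 - p.1) *
      ∫ x, ⟪ut p.2 x, LΨt p.1 x⟫) (νt.prod νt) := fun n =>
    (abs_integral_normed_mul_integral_inner_le (μ := (volume : Measure E)) (φn n) hLΨtm hutm hLΨt1 hutR).1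
  have hfF : ∀ n, Integrable (fun p : ℝ × ℝ => (φn n).normed volume (p.2 - p.1) * f p.1 p.2)
      (νt.prod νt) := fun n => by
    refine ((integrable_finsetSum Finset.univ fun i _ => piece_i i n).add
      ((piece_Δ n).const_mul ν)).congr ?_
    filter_upwards [hae_f] with p hp
    simp only [Pi.add_apply, hp]
    rw [mul_add, Finset.mul_sum]
    ring
  -- the limits of the pieces
  set Zi : Fin (Module.finrank ℝ E) → ℝ := fun i =>
    ∫ z, ⟪DΨt i z.1 z.2, Φt i z.1 z.2⟫ ∂(νt.prod (volume : Measure E)) with hZidef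
  set ZΔ : ℝ := ∫ z, ⟪ut z.1 z.2, LΨt z.1 z.2⟫ ∂(νt.prod (volume : Measure E)) with hZΔdef
  have lim_i : ∀ i, Tendsto (fun n => ∫ p, (φn n).normed volume (p.2 - p.1) *
      (∫ x, ⟪Φt i p.2 x, DΨt i p.1 x⟫) ∂(νt.prod νt)) atTop (𝓝 (Zi i)) := by
    intro i
    have h := FunctionSpaces.tendsto_integral_normed_mul_integral_inner_of_bound
      (μ := (volume : Measure E)) hφn h'φn (hΦtm i) (hDΨtm i) (hΦt1 i) (hDΨtC i)
    refine h.congr fun n => ?_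
    have hsw := integral_normed_mul_swap (t := t) (φn n) fun a b' => ∫ x, ⟪DΨt i b' x, Φt i a x⟫
    rw [hsw]
    refine integral_congr_ae (ae_of_all _ fun p => ?_)
    dsimp only
    rw [integral_inner_comm_aux']
  have lim_Δ : Tendsto (fun n => ∫ p, (φn n).normed volume (p.2 - p.1) *
      (∫ x, ⟪ut p.2 x, LΨt p.1 x⟫) ∂(νt.prod νt)) atTop (𝓝 ZΔ) :=
    FunctionSpaces.tendsto_integral_normed_mul_integral_inner hφn hLΨtm hutm hLΨt22 hut22
  have hf_lim : Tendsto (fun n => ∫ p, (φn n).normed volume (p.2 - p.1) * f p.1 p.2 ∂(νt.prod νt))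
      atTop (𝓝 ((∑ i, Zi i) + ν * ZΔ)) := by
    have h := (tendsto_finsetSum (Finset.univ) fun i _ => lim_i i).add (lim_Δ.const_mul ν)
    refine h.congr fun n => ?_
    rw [← integral_finsetSum _ fun i _ => piece_i i n, ← integral_const_mul,
      ← integral_add (integrable_finsetSum _ fun i _ => piece_i i n) ((piece_Δ n).const_mul ν)]
    refine integral_congr_ae ?_
    filter_upwards [hae_f] with p hp
    rw [hp, mul_add, Finset.mul_sum]
    ring
  -- ### the doubling identity
  have hmain := FunctionSpaces.doubling_identity ht.1 hQm hQb hA' hB' (hQ₁c.mono hsubIoo)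
    (hleftIcc hQ₁c) (hQ₂c.mono fun x hx => ⟨hx.1, hx.2.le.trans ht.2⟩) (hleftIoc hQ₂c)
    (hcc.mono hsubIoo) hcb hc0 (hc'c.mono fun x hx => ⟨hx.1, hx.2.le.trans ht.2⟩) hc'b hc'0 hφn
    hfF hgF hf_lim hg_lim
  -- ### identification of the bulk with the stated time integral
  -- iterated forms of the three limits
  have iZi : ∀ i, Integrable (fun z : ℝ × E => ⟪DΨt i z.1 z.2, Φt i z.1 z.2⟫)
      (νt.prod (volume : Measure E)) := by
    intro i
    refine ((hΦt1 i).norm.const_mul (K₁ * Rv)).mono'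
      (((hDΨtm i).inner (𝕜 := ℝ) (hΦtm i)).aestronglyMeasurable) (ae_of_all _ fun z => ?_)
    calc ‖⟪DΨt i z.1 z.2, Φt i z.1 z.2⟫‖ ≤ ‖DΨt i z.1 z.2‖ * ‖Φt i z.1 z.2‖ := norm_inner_le_norm _ _
      _ ≤ (K₁ * Rv) * ‖uncurry (Φt i) z‖ :=
          mul_le_mul_of_nonneg_right (hDΨtC i z.1 z.2) (norm_nonneg _)
  obtain ⟨iZΔ, -⟩ := integrable_inner_slab_of_eLpNorm_le (μ := (volume : Measure E)) hLΨtm hutm hLΨt1 hutR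
  obtain ⟨iZg, -⟩ := integrable_inner_slab_of_eLpNorm_le (μ := (volume : Measure E)) hAm hUtm hA1 hUtR
  have hbulk : (∑ i, Zi i) + ν * ZΔ + -Zg = ∫ s in Ioo 0 t, ((∫ x, (⟪u s x, fderiv ℝ (Ψ s) x (u s x)⟫ +
      ν * ⟪u s x, (Δ (Ψ s)) x⟫)) - ∫ x, ⟪S s x (v s x), U s x⟫) := by
    have e1 : ∀ i, Zi i = ∫ s, (∫ x, ⟪DΨt i s x, Φt i s x⟫) ∂νt := fun i => by
      rw [hZidef]; exact integral_prod _ (iZi i)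
    have e2 : ZΔ = ∫ s, (∫ x, ⟪ut s x, LΨt s x⟫) ∂νt := integral_prod _ iZΔ
    have e3 : Zg = ∫ s, (∫ x, ⟪Ut s x, A s x⟫) ∂νt := integral_prod _ iZg
    have j1 : ∀ i, Integrable (fun s => ∫ x, ⟪DΨt i s x, Φt i s x⟫) νt := fun i =>
      (iZi i).integral_prod_left
    have j2 : Integrable (fun s => ∫ x, ⟪ut s x, LΨt s x⟫) νt := iZΔ.integral_prod_left
    have j3 : Integrable (fun s => ∫ x, ⟪Ut s x, A s x⟫) νt := iZg.integral_prod_left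
    have key : (∫ s in Ioo 0 t, ((∫ x, (⟪u s x, fderiv ℝ (Ψ s) x (u s x)⟫ +
        ν * ⟪u s x, (Δ (Ψ s)) x⟫)) - ∫ x, ⟪S s x (v s x), U s x⟫)) =
        ∫ s, ((∑ i, ∫ x, ⟪DΨt i s x, Φt i s x⟫) + ν * (∫ x, ⟪ut s x, LΨt s x⟫) -
          ∫ x, ⟪Ut s x, A s x⟫) ∂νt := by
      refine integral_congr_ae ?_
      filter_upwards [hΨt_eq, hut', hUt_eq, hAt, (ae_restrict_mem measurableSet_Ioo : ∀ᵐ s ∂νt,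
        s ∈ Ioo 0 t)] with s hs1 hs2 hs3 hs4 hs5
      have hsI : s ∈ Icc 0 T := hsubIoo hs5
      have h1 := hf_slice s s hs1 hs2 hsI
      rw [hf] at h1
      dsimp only at h1
      rw [h1]
      congr 1
      · congr 1
        exact Finset.sum_congr rfl fun i _ => integral_inner_comm_aux' _ _
      · rw [← hs3, integral_inner_comm_aux']
        refine integral_congr_ae ?_
        filter_upwards [hs4] with x hx
        rw [hx]
    have jS : Integrable (fun s => ∑ i, ∫ x, ⟪DΨt i s x, Φt i s x⟫) νt :=
      integrable_finsetSum _ fun i _ => j1 i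
    have jsum : Integrable (fun s => (∑ i, ∫ x, ⟪DΨt i s x, Φt i s x⟫) +
        ν * ∫ x, ⟪ut s x, LΨt s x⟫) νt := jS.add (j2.const_mul ν)
    simp_rw [e1]
    rw [e2, e3, key, integral_sub jsum j3, integral_add jS (j2.const_mul ν),
      integral_finsetSum _ fun i _ => j1 i, integral_const_mul]
    ring
  have hQtt : Q t t = ∫ x, ⟪u t x, Ψ t x⟫ := by rw [hQ]
  rw [← hQtt, hmain, add_assoc, hbulk]

end Cross

end Literature.Analysis.FluidPDE
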